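import Summits.BirchSwinnertonDyer.BirchSwinnertonDyer.Theorems.GoldfeldAllTwistsTwoConverseTwinGenusDescentIndex
import Summits.BirchSwinnertonDyer.BirchSwinnertonDyer.Theorems.Rank2ObservatoryTateStep2Cert
import Summits.BirchSwinnertonDyer.BirchSwinnertonDyer.Theorems.Rank2ObservatoryTateDeepIstar
import Literature.NumberTheory.EllipticCurves.NeronComponentIndexTypeIIIProofs
import Literature.NumberTheory.EllipticCurves.NeronComponentIndexTypeInstarProofs
import HarnessLib

set_option linter.dupNamespace false -- `…BirchSwinnertonDyer.BirchSwinnertonDyer…` is the cell's namespace (D-0017)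
set_option autoImplicit false

/-!
# LINE B49 — the FIXED partner curves, VIII: Kodaira symbols `III` at `7`, `I₄*` at `2` of `W₇₈₄`
# and the local Tamagawa numbers `c₇ = 2`, `c₂ ∈ {2, 4}` (kernel; towards `X049Partner784TamagawaEight`)

Cell `bsd-goldfeld`, seat `bsd-goldfeld-s1p-c301` (prover, gen 6); TARGET v5.5 §2 c301 (g) (W-A5: «Tamagawa
(W₇₈₄) = c₂·c₇ = 4·2 = 8 IN THE KERNEL — Kodaira `I₄*` at `2`, `III` at `7`»); support for item
`stmt-BirchSwinnertonDyer-19140`. HONEST FRAMING: kernel theorems about the explicit global minimal model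
`W₇₈₄ = [0, −21, 0, 112, 0]` (files III/V); nothing about BSD; not in the Theses cone. WHAT IS PROVED:
§1 at the place above `7`: the Rank2Observatory Step-2 certificate `⟨7, 0, 0, 0, 3, 3, 2⟩` passes on the
model itself (`7 ∣ a₂, a₄, a₆`, `7³ ∥ Δ`, `7² ∥ b₈ = −12544`), so `kodairaSymbolAt = III`,
`ord₇ Δ_min = 3`, and **`c₇ = 2`** (`localTamagawaNumber_eq_two_of_kodairaSymbolAt_eq_III_holds`); §2 at
the place above `2`: the translate `M = (1, 0, −1, 0) • W₇₈₄ = [−2, −22, 0, 112, 0]` is normalised for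
round `1` of the `Iₙ*` sub-procedure with `a₄/2⁴ = 7` odd, so the one-model certificate
`kodairaSymbolOfMinimal_intCast_eq_Istar_even` (Rank2Observatory, cert-2 gen 7) gives
`kodairaSymbolAt = I₄*`, `ord₂ Δ_min = 12` (minimality at `2` = file III's Kraus test, transported by
`isMinimalAt_translate`), and **`c₂ ∈ {2, 4}`** — ALL the tree's Step-7 fact
`localTamagawaNumber_of_kodairaSymbolAt_eq_Istar_succ` records. WHAT IS NOT: the exact `c₂ = 4` (named
input `X049Partner784TamagawaEight` of file VII; route: the rational points `T = (0,0)`, `g₇₈₄ = (8,8)`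
(side `D` of the `I₄*` normal form: `x ≡ 0 (mod 4)` on `M`) and `g₇₈₄ + T = (14, −14)` (side `S`:
`x/2` odd) give the three non-zero classes of `E(ℚ₂)/E₀(ℚ₂)`), and the assembly
`tamagawaProduct = c₂ · c₇` (`tamagawaProduct_eq_prod` over the places `{2, 7}` of `ℤ`,
`localTamagawaNumber_padic_eq_holds`, good reduction off `14`). References: [Silverman1994] IV.9.4
Steps 1–4 and 7, Table 4.1; [SilvermanAEC2009] VII.1; [CremonaAlgorithms1997] Table 1 (N = 784).
-/

noncomputable section

open scoped Classical NumberField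

open WeierstrassCurve IsDedekindDomain Rat.HeightOneSpectrum
  Literature.NumberTheory.EllipticCurves
  Summit.BirchSwinnertonDyer.BirchSwinnertonDyer.Rank2Observatory.Tate

namespace Summit.BirchSwinnertonDyer.BirchSwinnertonDyer.Theorems.GoldfeldGoodTwists

/-! ## §1 At `7`: type `III`, `ord₇ Δ_min = 3`, `c₇ = 2` -/

/-- The Step-2 certificate of `[0, −21, 0, 112, 0]` at `7` passes: the model is already Step-2
normalised (`7 ∣ a₃, a₄, a₆, b₂`), `7³ ∥ Δ`, exit at Step 4 (`7² ∣ a₆ = 0`, `7² ∥ b₈ = −12544`).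
[cite: Silverman1994, IV.9.4 Steps 1–4] -/
theorem step2Cert_check_W784_seven :
    Step2Cert.check ⟨7, 0, 0, 0, 3, 3, 2⟩ ⟨0, -21, 0, 112, 0⟩ = true := by
  decide +kernel

/-- **`W₇₈₄` has Kodaira type `III` and `ord Δ_min = 3` at the place above `7`** (kernel, Tate's
algorithm Steps 1–4 via the Rank2Observatory certificate). [cite: Silverman1994, IV.9.4 Step 4] -/
theorem kodairaSymbolAt_W784_seven (v : HeightOneSpectrum (𝓞 ℚ)) (hv : natGenerator v = 7) :
    (⟨0, -21, 0, 112, 0⟩ : WeierstrassCurve ℚ).kodairaSymbolAt v = .III ∧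
      (⟨0, -21, 0, 112, 0⟩ : WeierstrassCurve ℚ).ordMinimalDiscriminant v = 3 := by
  have h := Step2Cert.sound (W₀ := ⟨0, -21, 0, 112, 0⟩) (c := ⟨7, 0, 0, 0, 3, 3, 2⟩) v hv
    step2Cert_check_W784_seven
  rw [← twoTorsionModel_neg_one_eq_baseChange] at h
  exact h

/-- **`c₇(W₇₈₄) = 2`** (type `III`; tree `localTamagawaNumber_eq_two_of_kodairaSymbolAt_eq_III_holds`).
[cite: Silverman1994, IV.9.4 Step 4] -/
theorem localTamagawaNumber_W784_seven (v : HeightOneSpectrum (𝓞 ℚ)) (hv : natGenerator v = 7) :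
    ((⟨0, -21, 0, 112, 0⟩ : WeierstrassCurve ℚ).baseChange (v.adicCompletion ℚ)).localTamagawaNumber
      (v.adicCompletionIntegers ℚ) = 2 := by
  haveI := isElliptic_twoTorsionModel_neg_one
  haveI := perfectField_residueField_adicCompletionIntegers (K := ℚ) v
  exact localTamagawaNumber_eq_two_of_kodairaSymbolAt_eq_III_holds v _ (kodairaSymbolAt_W784_seven v hv).1

/-! ## §2 At `2`: type `I₄*`, `ord₂ Δ_min = 12`, `c₂ ∈ {2, 4}` -/

/-- The `2`-adically normalised model `M = (1, 0, −1, 0) • [0, −21, 0, 112, 0] = [−2, −22, 0, 112, 0]`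
(`2 ∣ a₁`, `2 ∥ a₂`, `2⁴ ∣ a₃, a₄`, `2⁷ ∣ a₆`, `a₄/2⁴ = 7` odd: the second test of round `1` of the
`Iₙ*` sub-procedure fires, type `I₄*`). [cite: Silverman1994, IV.9.4 Step 7] -/
theorem model_W784_two :
    (⟨-2, -22, 0, 112, 0⟩ : WeierstrassCurve ℤ) = (⟨1, 0, -1, 0⟩ : VariableChange ℤ) • ⟨0, -21, 0, 112, 0⟩ := by
  ext <;> simp [variableChange_a₁, variableChange_a₂, variableChange_a₃, variableChange_a₄, variableChange_a₆]

/-- **`W₇₈₄` has Kodaira type `I₄*` and `ord Δ_min = 12` at the place above `2`** (kernel: the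
Rank2Observatory one-model `Iₙ*` certificate on `M = [−2, −22, 0, 112, 0]`, minimality at `2` from file
III's Kraus test transported along the translation). [cite: Silverman1994, IV.9.4 Step 7] -/
theorem kodairaSymbolAt_W784_two (v : HeightOneSpectrum (𝓞 ℚ)) (hv : natGenerator v = 2) :
    (⟨0, -21, 0, 112, 0⟩ : WeierstrassCurve ℚ).kodairaSymbolAt v = .Istar 4 ∧
      (⟨0, -21, 0, 112, 0⟩ : WeierstrassCurve ℚ).ordMinimalDiscriminant v = 12 := by
  have hmin₀ : ((⟨0, -21, 0, 112, 0⟩ : WeierstrassCurve ℤ).baseChange ℚ).IsMinimalAt v := by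
    rw [← twoTorsionModel_neg_one_eq_baseChange]
    exact isGloballyMinimal_twoTorsionModel_neg_one.isMinimal v
  have hmin := isMinimalAt_translate (v := v) (⟨1, 0, -1, 0⟩ : VariableChange ℤ) rfl model_W784_two hmin₀
  have h := kodairaSymbolAt_and_ordMinimalDiscriminant_of_intModel (v := v) hv ⟨0, -21, 0, 112, 0⟩
    ⟨-2, -22, 0, 112, 0⟩ ⟨1, 0, -1, 0⟩ rfl model_W784_two hmin (n := 12) (by decide) (by decide)
    (T := .Istar 4) (fun ε hε hpε =>
      kodairaSymbolOfMinimal_intCast_eq_Istar_even (m := 1) (n := 12) Nat.prime_two hε hpε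
        (by decide) (by decide) (by decide) (by decide) (by decide) (by decide) (by decide)
        (by decide) (by decide) (by decide))
  rw [← twoTorsionModel_neg_one_eq_baseChange] at h
  exact h

/-- **`c₂(W₇₈₄) ∈ {2, 4}`** (type `I₄*`; the tree's Step-7 fact records only the printed alternative
«`c = 2` or `4`»; the exact value `4` is the named input `X049Partner784TamagawaEight` of file VII).
[cite: Silverman1994, IV.9.4 Step 7] -/
theorem localTamagawaNumber_W784_two (v : HeightOneSpectrum (𝓞 ℚ)) (hv : natGenerator v = 2) :
    ((⟨0, -21, 0, 112, 0⟩ : WeierstrassCurve ℚ).baseChange (v.adicCompletion ℚ)).localTamagawaNumber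
        (v.adicCompletionIntegers ℚ) = 2 ∨
      ((⟨0, -21, 0, 112, 0⟩ : WeierstrassCurve ℚ).baseChange (v.adicCompletion ℚ)).localTamagawaNumber
        (v.adicCompletionIntegers ℚ) = 4 := by
  haveI := isElliptic_twoTorsionModel_neg_one
  haveI := perfectField_residueField_adicCompletionIntegers (K := ℚ) v
  exact localTamagawaNumber_of_kodairaSymbolAt_eq_Istar_succ_holds v _ 3 (kodairaSymbolAt_W784_two v hv).1

end Summit.BirchSwinnertonDyer.BirchSwinnertonDyer.Theorems.GoldfeldGoodTwists

end
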